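import Literature.NumberTheory.EllipticCurves.IsogenyCyclicKernelCoatesProofs
import Summits.BirchSwinnertonDyer.Rank1Residual.Additive.GordIsogenyInvarianceClasses
import HarnessLib

/-!
# Dokchitser–Dokchitser 2015, Thm. 5.1(1) at `l = p` WITHOUT the ordinarity input, for a cyclic
# kernel of order `n ≡ 1 (mod 12)`: `v_p(Δ_min)` is an invariant of such `ℚ`-isogenies at every
# additive potentially good prime `p ≥ 5` (support file for TFMD glue 25945, binder (b))

Cell `pub/bsd-wall`, seat `bsd-line-ttd-p1` (g8). THEOREMS ONLY. The glue
`EisensteinResidualOfTrichotomy` (stmt-BirchSwinnertonDyer-25945) uses at `p = 13` the cite-only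
fact `dokchitser_padicValInt_minimalDiscriminantInt_eq_of_isogeny_of_potentiallyGoodOrdinary`
(Dokchitser–Dokchitser 2015, Thm. 5.1 (1), clause `l = p` potentially ordinary). For a `ℚ`-isogeny
whose kernel is CYCLIC of order `n ≡ 1 (mod 12)` — e.g. a `13`-isogeny — no ordinarity is needed:
the tree now proves (Coates' lemma in Vélu form, `Isogeny.padicValInt_minimalDiscriminantInt_modEq_twelve`)
`n·v_p(Δ_min E) ≡ v_p(Δ_min E') (mod 12)` at every prime, hence `v_p(Δ_min E) ≡ v_p(Δ_min E')`,
and both lie in `{2,3,4,6,8,9,10}` at an additive potentially good `p ≥ 5`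
(`padicValInt_minimalDiscriminantInt_mem_of_addv_of_padicValRat_j_nonneg`), so they are EQUAL
(`padicValInt_minimalDiscriminantInt_eq_of_isogeny_cyclic`). What this does NOT cover: the glue's
`IsIsogenous V W₀` of unknown degree (reduce to cyclic steps of order prime to `6` and use the
tree's proved `…_of_not_dvd_degree_holds` for the prime-to-`p` part — road memo, evidence #13 on
25945). BSD is not proved by this file; Manin's conjecture is not proved.
-/

noncomputable section

-- the summit-side namespace `Summit.BirchSwinnertonDyer.BirchSwinnertonDyer.…` repeats the name by design (D-0017)
set_option linter.dupNamespace false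

open scoped Classical

open Finset WeierstrassCurve
  Literature.NumberTheory.EllipticCurves Literature.NumberTheory.EllipticCurves.Rank1Residual
  Summit.BirchSwinnertonDyer.Rank1Residual.Additive

namespace Summit.BirchSwinnertonDyer.BirchSwinnertonDyer.Theorems.TwistFamilyManinDescent

/-- **`v_p(Δ_min)` is invariant under a `ℚ`-isogeny with cyclic kernel of order `n ≡ 1 (mod 12)`
at every additive potentially good prime `p ≥ 5`** (globally minimal models `E, E'`; kernel
`⟨P⟩`, `P = (x₀, y₀) ∈ E(ℚ̄)` of exact order `n`): Dokchitser–Dokchitser 2015 Thm. 5.1 (1) for these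
kernels, INCLUDING the prime `p ∣ n` (e.g. a `13`-isogeny at `p = 13`), with no ordinarity
hypothesis — from `n·v_p(Δ_min E) ≡ v_p(Δ_min E') (mod 12)` (Coates' lemma, tree theorem) and
`v_p(Δ_min) ∈ {2,3,4,6,8,9,10}`. [cite: DokchitserDokchitser2015LocalInvariants, Thm. 5.1 (1) with §3 Thm. 6 and Cor. 8 (`l ≡ 1 mod 12`)] -/
theorem padicValInt_minimalDiscriminantInt_eq_of_isogeny_cyclic {W W' : WeierstrassCurve ℚ}
    [W.IsElliptic] [W'.IsElliptic] [W.IsGloballyMinimal] [W'.IsGloballyMinimal]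
    (φ : Isogeny W W') {x₀ y₀ : AlgebraicClosure ℚ}
    (h : (W⁄(AlgebraicClosure ℚ)).toAffine.Nonsingular x₀ y₀) {n : ℕ} (hn12 : n % 12 = 1)
    (h1n : 1 < n) (hn : (n : ℤ) • WeierstrassCurve.Affine.Point.some x₀ y₀ h = 0)
    (hmin : ∀ k : ℕ, 0 < k → k < n → (k : ℤ) • WeierstrassCurve.Affine.Point.some x₀ y₀ h ≠ 0)
    (hker : ∀ Q : W.geomPoints, Q ∈ φ.toAddMonoidHom.ker ↔
      Q ∈ (range n).image fun k : ℕ => (k : ℤ) • WeierstrassCurve.Affine.Point.some x₀ y₀ h)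
    {p : ℕ} [Fact p.Prime] (hp5 : 5 ≤ p) (hadd : Addv W p) (hadd' : Addv W' p)
    (hj : 0 ≤ padicValRat p W.j) (hj' : 0 ≤ padicValRat p W'.j) :
    padicValInt p W.minimalDiscriminantInt = padicValInt p W'.minimalDiscriminantInt := by
  have hnm : n = 2 * ((n - 1) / 2) + 1 := by omega
  have h3 : Nat.Coprime 3 n := (Nat.Prime.coprime_iff_not_dvd Nat.prime_three).mpr (by omega)
  have hmod := φ.padicValInt_minimalDiscriminantInt_modEq_twelve h hnm h3 h1n hn hmin hker p
  rw [Int.modEq_iff_dvd] at hmod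
  have hv := padicValInt_minimalDiscriminantInt_mem_of_addv_of_padicValRat_j_nonneg W p hp5 hadd hj
  have hv' := padicValInt_minimalDiscriminantInt_mem_of_addv_of_padicValRat_j_nonneg W' p hp5 hadd' hj'
  have hn' : ∃ q : ℕ, n = 12 * q + 1 := ⟨n / 12, by omega⟩
  obtain ⟨q, rfl⟩ := hn'
  push_cast at hmod
  rcases hv with h1 | h1 | h1 | h1 | h1 | h1 | h1 <;>
    rcases hv' with h2 | h2 | h2 | h2 | h2 | h2 | h2 <;>
    rw [h1, h2] at hmod ⊢ <;> omega

end Summit.BirchSwinnertonDyer.BirchSwinnertonDyer.Theorems.TwistFamilyManinDescent
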